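import Literature.AlgebraicGeometry.Morphisms.AffineSpaceCompactification
import Mathlib.AlgebraicGeometry.Morphisms.ClosedImmersion
import Mathlib.AlgebraicGeometry.Morphisms.Proper
import Mathlib.AlgebraicGeometry.Morphisms.Finite
import HarnessLib

/-!
# Projective morphisms of schemes (Hartshorne's definition) over an arbitrary base scheme

Topic `Literature/AlgebraicGeometry/Morphisms`. Mathlib has proper morphisms but no projective morphisms; the tree has
projectivity over a FIELD (`Literature.AlgebraicGeometry.Motives.IsProjectiveOver`: a closed `k`-immersion into some
`ℙⁿ_k`) and over a RING (`Literature.AlgebraicGeometry.Crystalline.IsProjectiveOverRing`), and projective space over an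
arbitrary SCHEME `Morphisms.projectiveSpace ι S = S ×_{Spec ℤ} ℙ^{#ι}_ℤ` with its proper structure map
`projectiveSpaceFst` (`AffineSpaceCompactification.lean`, Stacks 01WC). This file adds the morphism property:

* `IsProjective f` — **`f : X → Y` is projective** (Hartshorne II §4, Definition p.103): `f` factors as a closed immersion
  `X ↪ ℙ(ι; Y)` into a projective space over `Y` (`ι` finite) followed by the projection `ℙ(ι; Y) → Y`. This is EGA's
  /Stacks' «H-projective» (Tag 01W8); it agrees with EGA's projective (closed immersion into `ℙ(𝓔)`) over bases with an
  ample invertible sheaf, e.g. affine bases — not recorded here.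
* `isProjective_projectiveSpaceFst` — `ℙ(ι; Y) → Y` is projective (Hartshorne II §4, the definition with `j = id`).
* `IsProjective.comp_isClosedImmersion` — a closed immersion followed by a projective morphism is projective.
* `IsProjective.isProper` — **projective ⇒ proper** (Hartshorne II Thm. 4.9): closed immersions are proper and
  `ℙ(ι; Y) → Y` is proper (tree `isProper_projectiveSpaceFst`).

Consumer: the HIRONAKA campaign's M-Hu rung (`Hu2025/Statements/S08MainTheorem`: «a projective birational morphism from
`X̃` onto `X`», arXiv:2507.21400v1 p.158), which needs projectivity over a non-affine, non-field base.

## Sources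
* R. Hartshorne, *Algebraic Geometry*, GTM 52 (1977), II §4: Definition (projective morphism) p.103; Thm. 4.9 p.103
  (projective ⇒ proper). [Hartshorne1977]
* The Stacks Project, Tag 01W8 (H-projective), Tag 01WC (ℙⁿ_S proper). [StacksProject]
-/

noncomputable section

universe u

open CategoryTheory CategoryTheory.Limits AlgebraicGeometry

namespace Literature.AlgebraicGeometry.Morphisms

variable {X Y : Scheme.{u}}

/-- **Projective morphism** (Hartshorne II §4, Definition p.103): `f : X → Y` is projective if it factors as a closed
immersion `j : X ↪ ℙ(ι; Y) = Y ×_ℤ ℙ^{#ι}_ℤ` into a projective space over `Y` (`ι` a finite type) followed by the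
structure projection `ℙ(ι; Y) → Y`. (Stacks' «H-projective», Tag 01W8.)
[cite: Hartshorne1977, II §4 Definition p.103 (projective morphism)] -/
def IsProjective (f : X ⟶ Y) : Prop :=
  ∃ (ι : Type u) (_ : Finite ι) (j : X ⟶ projectiveSpace ι Y),
    IsClosedImmersion j ∧ j ≫ projectiveSpaceFst ι Y = f

/-- **`ℙ(ι; Y) → Y` is projective** (the definition with the identity as the closed immersion).
[cite: Hartshorne1977, II §4 Definition p.103 (projective morphism)] -/
theorem isProjective_projectiveSpaceFst (ι : Type u) [Finite ι] (Y : Scheme.{u}) :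
    IsProjective (projectiveSpaceFst ι Y) :=
  ⟨ι, inferInstance, 𝟙 _, inferInstance, Category.id_comp _⟩

/-- **A closed immersion followed by a projective morphism is projective** (compose the closed immersions).
[cite: Hartshorne1977, II §4 Definition p.103 (projective morphism)] -/
theorem IsProjective.comp_isClosedImmersion {W : Scheme.{u}} {f : X ⟶ Y} (hf : IsProjective f) (g : W ⟶ X)
    [IsClosedImmersion g] : IsProjective (g ≫ f) := by
  obtain ⟨ι, hι, j, hj, hjf⟩ := hf
  haveI := hj
  exact ⟨ι, hι, g ≫ j, inferInstance, by rw [Category.assoc, hjf]⟩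

/-- **Projective morphisms are proper** (Hartshorne II Thm. 4.9): a closed immersion is proper and `ℙ(ι; Y) → Y` is
proper (base change of `ℙⁿ_ℤ → Spec ℤ`, tree `isProper_projectiveSpaceFst`), and proper morphisms compose.
[cite: Hartshorne1977, II Thm. 4.9 p.103 (a projective morphism is proper)] -/
theorem IsProjective.isProper {f : X ⟶ Y} (hf : IsProjective f) : IsProper f := by
  obtain ⟨ι, hι, j, hj, hjf⟩ := hf
  haveI := hj
  rw [← hjf]
  infer_instance

/-- A projective morphism is universally closed (it is proper). [cite: Hartshorne1977, II Thm. 4.9 p.103 (a projective morphism is proper)] -/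
theorem IsProjective.universallyClosed {f : X ⟶ Y} (hf : IsProjective f) : UniversallyClosed f := by
  haveI := hf.isProper
  infer_instance

end Literature.AlgebraicGeometry.Morphisms

end
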